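import Literature.Analysis.FluidPDE.LocalBiotSavartLog
import HarnessLib

/-!
# The Beale–Kato–Majda logarithmic gradient bound with LOCAL energy (no decay at infinity)

Analysis/FluidPDE proof file (theorems only, no definitions, no named facts), a one-theorem sequel
of `LocalBiotSavartLog`. The tree's `exists_opNorm_fderiv_le_log` (Majda–Bertozzi 2002, §3.3,
Prop. 3.8 / (3.87): `‖Dv(x)‖ ≤ C((H + Ω)δ^{1/2} + Ω log(1/δ) + ‖v‖_{L²(ℝ³)})` for smooth
divergence-free `v ∈ L²(ℝ³)` with `curl v` `½`-Hölder with constant `H` and bounded by `Ω`) asks for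
finite energy on all of `ℝ³`. Its proof, however, is LOCAL: the local Biot–Savart law on the unit
ball about `x` (`LocalBiotSavart`, after Tao 2011 §10) involves `v` only on `B(x, 3)`, and the
smoothing remainder has the local form `sum_abs_fderiv_smoothing_le_sqrt_local`. Running the printed
proof with that remainder gives

* `exists_opNorm_fderiv_le_log_local` — the same estimate with `‖v‖_{L²(B(x,3))}` in place of
  `‖v‖_{L²(ℝ³)}` and NO integrability hypothesis on `v`.

This is the form needed for fields without decay, in particular for the `ℤ³`-periodic lift of a
field on the torus `T³` (`TorusBKMGradientLogBound`, Doering–Gibbon 1995, Thm. 7.5).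

## Mathlib / tree search

Tree (all used): `exists_isHolderCZKernel_newtonNearHess` (`NewtonNearCZ`),
`exists_norm_fderiv_ballCutoff_le` (`BallCutoff`), `opNorm_fderiv_le_hessMajorant_add`,
`sum_abs_fderiv_smoothing_le_sqrt_local`, `hessMajorant`, `hessPot`, `locVel` (`LocalBiotSavart`),
`abs_hessPot_le_log` (`LocalBiotSavartLog`), `lamGradL2`, `lamGradL2_nonneg`
(`LocalBiotSavartCalculus`), `NewtonPotentialHolder.three_mul_volume_real_ball_nonneg`. The global
form `exists_opNorm_fderiv_le_log` is the only logarithmic gradient bound of this kind in the tree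
(searched `opNorm_fderiv_le`, `le_log`).

## References

* A. J. Majda, A. L. Bertozzi, *Vorticity and Incompressible Flow*, CUP 2002, §3.3, Prop. 3.8 and
  its proof, (3.85)–(3.87) (pp. 116–117). [MajdaBertozzi2002]
* J. T. Beale, T. Kato, A. Majda, Comm. Math. Phys. 94 (1984), 61–66, (13)–(14).
  [BealeKatoMajda1984]
* T. Tao, *Localisation and compactness properties of the Navier–Stokes global regularity
  problem*, arXiv:1108.1165, §10 (the local Biot–Savart law). [Tao2011]
-/

noncomputable section

open MeasureTheory Set Function Filter Metric Real
open _root_.Topology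
open scoped NNReal ENNReal ContDiff

namespace Literature.Analysis.FluidPDE

open NewtonPotentialHolder

/-- **Majda–Bertozzi (3.87) with local energy.** There is an absolute constant `C` such that for
every smooth divergence-free `v` on `ℝ³` (no decay assumed), every `½`-Hölder constant `H` and sup
bound `Ω` of `curl v`, every `0 < δ ≤ 1` and every `x`,
`‖Dv(x)‖ ≤ C ( (H + Ω) δ^{1/2} + Ω log(1/δ) + ‖v‖_{L²(B(x,3))} )`. The proof is that of the tree's
`exists_opNorm_fderiv_le_log` with the smoothing remainder taken in its local form
`sum_abs_fderiv_smoothing_le_sqrt_local` (the local Biot–Savart law on `B(x,1)` involves `v` only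
on `B(x,3)`). [cite: MajdaBertozzi2002, §3.3 Prop. 3.8, (3.87) (p. 117)] -/
theorem exists_opNorm_fderiv_le_log_local :
    ∃ C : ℝ, 0 ≤ C ∧ ∀ (v : (EuclideanSpace ℝ (Fin 3)) → (EuclideanSpace ℝ (Fin 3))),
      ContDiff ℝ ∞ v → VectorCalculus.IsDivFree v →
      ∀ (H Ω : ℝ≥0), HolderWith H (1 / 2) (curl v) → (∀ y, ‖curl v y‖ ≤ Ω) →
      ∀ δ : ℝ, 0 < δ → δ ≤ 1 → ∀ x : (EuclideanSpace ℝ (Fin 3)),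
        ‖fderiv ℝ v x‖ ≤ C * ((H + Ω) * δ ^ (1 / 2 : ℝ) + Ω * Real.log (1 / δ) +
          Real.sqrt (∫ y in ball x 3, ‖v y‖ ^ 2)) := by
  obtain ⟨A, B, A₀, hA, -, -, hK⟩ :=
    exists_isHolderCZKernel_newtonNearHess (r₀ := (1 / 2 : ℝ)) (r₁ := 1) (by norm_num) (by norm_num)
  obtain ⟨C₀, hC₀, hψ⟩ := exists_norm_fderiv_ballCutoff_le
  set c₃ : ℝ := 3 * (volume : Measure (EuclideanSpace ℝ (Fin 3))).real (ball 0 1) with hc₃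
  have hc₃0 : 0 ≤ c₃ := three_mul_volume_real_ball_nonneg
  set C : ℝ := 162 * A * c₃ * (1 + Real.sqrt C₀) + 3 * lamGradL2 with hC
  have hS0 : 0 ≤ Real.sqrt C₀ := Real.sqrt_nonneg _
  have hL0 : 0 ≤ lamGradL2 := lamGradL2_nonneg
  have hC0 : 0 ≤ C := by rw [hC]; positivity
  refine ⟨C, hC0, fun v hv hdiv H Ω hH hΩ δ hδ hδ1 x => ?_⟩
  have hψ1 : ∀ y, ‖fderiv ℝ (ballCutoff x 1) y‖ ≤ C₀ := fun y => by
    have := hψ x 1 one_pos y; rwa [div_one] at this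
  have hlog0 : 0 ≤ Real.log (1 / δ) := Real.log_nonneg ((one_le_div hδ).2 hδ1)
  have hd0 : 0 ≤ δ ^ (1 / 2 : ℝ) := Real.rpow_nonneg hδ.le _
  have hE0 : 0 ≤ Real.sqrt (∫ y in ball x 3, ‖v y‖ ^ 2) := Real.sqrt_nonneg _
  -- the local Biot–Savart law on the unit ball about `x`
  have hrep := opNorm_fderiv_le_hessMajorant_add (c := x) hv hdiv one_pos (mem_ball_self one_pos)
  have hfar := sum_abs_fderiv_smoothing_le_sqrt_local (c := x) hv one_pos x
  have hfar' : ∑ k, ∑ m,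
      |fderiv ℝ (newtonFarSmoothing (1 / 2) 1 (locVel v x 1 m)) x (EuclideanSpace.single k (1 : ℝ))| ≤
      3 * lamGradL2 * Real.sqrt (∫ y in ball x 3, ‖v y‖ ^ 2) := by
    have e : Real.sqrt ((1 : ℝ)⁻¹ ^ 5) = 1 := by norm_num
    have e3 : ((3 : ℝ) * 1) = 3 := by norm_num
    rw [e, one_mul, e3] at hfar
    simpa [mul_comm, mul_assoc, mul_left_comm] using hfar
  -- the 27 Hessian entries
  set bd : ℝ := A * c₃ *
    ((H + Ω * Real.sqrt C₀) * (δ ^ (1 / 2 : ℝ) / (1 / 2)) + 2 * Ω * Real.log (1 / δ)) with hbd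
  have hentry : ∀ k a b : Fin 3, |hessPot v x 1 k a b x| ≤ bd := fun k a b =>
    abs_hessPot_le_log (c := x) hv hH hΩ hC₀ hψ1 hK hδ hδ1 k a b x
  have hmaj : hessMajorant v x 1 x ≤ 27 * bd := by
    rw [hessMajorant]
    calc ∑ k, ∑ a, ∑ b, |hessPot v x 1 k a b x| ≤ ∑ _k : Fin 3, ∑ _a : Fin 3, ∑ _b : Fin 3, bd := by
          gcongr with k _ a _ b _
          exact hentry k a b
      _ = 27 * bd := by simp; ring
  -- assemble
  have hH0 : (0 : ℝ) ≤ H := H.coe_nonneg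
  have hΩ0 : (0 : ℝ) ≤ Ω := Ω.coe_nonneg
  have hbd_le : 81 * bd ≤ 162 * A * c₃ * (1 + Real.sqrt C₀) *
      ((H + Ω) * δ ^ (1 / 2 : ℝ) + Ω * Real.log (1 / δ)) := by
    rw [hbd]
    have h1 : (H : ℝ) + Ω * Real.sqrt C₀ ≤ (1 + Real.sqrt C₀) * (H + Ω) := by
      nlinarith [mul_nonneg hH0 hS0, mul_nonneg hΩ0 hS0]
    have h2 : A * c₃ * ((H + Ω * Real.sqrt C₀) * (δ ^ (1 / 2 : ℝ) / (1 / 2))) ≤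
        2 * A * c₃ * (1 + Real.sqrt C₀) * ((H + Ω) * δ ^ (1 / 2 : ℝ)) := by
      have := mul_le_mul_of_nonneg_right h1 (mul_nonneg (mul_nonneg hA hc₃0) hd0)
      nlinarith [this]
    have h3 : A * c₃ * (2 * Ω * Real.log (1 / δ)) ≤
        2 * A * c₃ * (1 + Real.sqrt C₀) * (Ω * Real.log (1 / δ)) := by
      have h4 : (1 : ℝ) ≤ 1 + Real.sqrt C₀ := by linarith
      have h5 : 0 ≤ 2 * A * c₃ * (Ω * Real.log (1 / δ)) := by positivity
      nlinarith [mul_le_mul_of_nonneg_left h4 h5]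
    nlinarith [h2, h3]
  calc ‖fderiv ℝ v x‖ ≤ 3 * hessMajorant v x 1 x +
        ∑ k, ∑ m, |fderiv ℝ (newtonFarSmoothing (1 / 2) 1 (locVel v x 1 m)) x
          (EuclideanSpace.single k (1 : ℝ))| := hrep
    _ ≤ 3 * (27 * bd) + 3 * lamGradL2 * Real.sqrt (∫ y in ball x 3, ‖v y‖ ^ 2) := by gcongr
    _ = 81 * bd + 3 * lamGradL2 * Real.sqrt (∫ y in ball x 3, ‖v y‖ ^ 2) := by ring
    _ ≤ 162 * A * c₃ * (1 + Real.sqrt C₀) * ((H + Ω) * δ ^ (1 / 2 : ℝ) + Ω * Real.log (1 / δ)) +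
          3 * lamGradL2 * Real.sqrt (∫ y in ball x 3, ‖v y‖ ^ 2) := by gcongr
    _ ≤ C * ((H + Ω) * δ ^ (1 / 2 : ℝ) + Ω * Real.log (1 / δ)) +
          C * Real.sqrt (∫ y in ball x 3, ‖v y‖ ^ 2) := by
        have hX0 : 0 ≤ (H + Ω) * δ ^ (1 / 2 : ℝ) + Ω * Real.log (1 / δ) := by positivity
        have i1 : 162 * A * c₃ * (1 + Real.sqrt C₀) ≤ C := by rw [hC]; nlinarith
        have i2 : 3 * lamGradL2 ≤ C := by rw [hC]; nlinarith [mul_nonneg (mul_nonneg hA hc₃0) hS0]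
        gcongr
    _ = C * ((H + Ω) * δ ^ (1 / 2 : ℝ) + Ω * Real.log (1 / δ) +
          Real.sqrt (∫ y in ball x 3, ‖v y‖ ^ 2)) := by ring

end Literature.Analysis.FluidPDE

end
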